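import Mathlib
import Summits.ResolutionOfSingularities.ResolutionOfSingularities.Theorems.WildQuotientsWildQuotientResolutionJordanFiveMu2CoverSubstDefs
import Summits.ResolutionOfSingularities.ResolutionOfSingularities.Theorems.WildQuotientsWildQuotientResolutionJordanFiveMu2CoverDescent
import Summits.ResolutionOfSingularities.ResolutionOfSingularities.Theorems.WildQuotientsWildQuotientResolutionJordanFiveMu2CoverKL
import Summits.ResolutionOfSingularities.ResolutionOfSingularities.Theorems.WildQuotientsWildQuotientResolutionJordanFiveX0ChartTools

/-!
# RUNG V5 (`J₅`), brick B7/HP₂ — the cover substitution: intertwining and the centre dictionary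

Sub-problem `ResolutionOfSingularities`, crux `WildQuotients.WildQuotientResolution`
(stmt-ResolutionOfSingularities-15640), line L1 W4.5c, scaffold
`JordanFive.jordanFive_hasResolution_of_bricks` (p527978), brick `HP₂` (res-L1-w45c-plan-1 RULINGs
10:50Z / 14:04:47Z; W2-DESIGN §6 of res-L1-w45c-idea-2). [OURS · L1 W4.5c]

For the cover substitution `coverSubst : x_a ↦ s⁴Y₀, x_b ↦ s³Y₁, x_c ↦ s²Y₂, x_d ↦ sY₃, x_i ↦ Y_i`
(…`Mu2CoverSubstDefs`):

* **intertwining** `coverSubst_comp_eq`: `coverSubst ∘ σ = σ_A ∘ coverSubst` for the `J₅` law `σ`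
  (`x_b ↦ x_b + x_a, …, x_e ↦ x_e + x_d`) and the cover law `σ_A` (`Y_j ↦ Y_j + sY_{j−1}`), and
  `apply_coverSubst_of_tauLaws`: `τ_A ∘ coverSubst = coverSubst` for the deck involution; the
  `U`-level forms `cover_apply_algebraMap_coverSubst`, `coverTau_apply_algebraMap_coverSubst`
  (for ANY `σ_U`, `τ_U` with the laws on a localisation `U` of `k[s,Y,pass] ⧸ I` away from `ι`) —
  the input of the (W₂-B) range conversion;
* **the centre dictionary** `radical_span_coverCentre_eq`: for a ring map `θ : k[s,Y,pass] → U`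
  into a domain with `θ s ≠ 0`, `θ î` a unit, and elements `u_j` (`j ∉ {0,2,5,13}`) with
  `θ(coverSubst i₂³)·u_j = θ(coverSubst g_j)`:
  `√⟨θ(coverSubst x_a), …, θ(coverSubst x_d), u_j⟩ = √⟨θ s, θ Y₁, θ Y₃⟩` — the pulled-back centre of
  `HP₂` is, up to radical, the ideal of the `τ`-odd coordinates (the fixed locus of the deck
  involution).
-/

-- single-problem summit: the doubled namespace component `ResolutionOfSingularities` is forced
set_option linter.dupNamespace false

noncomputable section

open MvPolynomial

namespace Summit.ResolutionOfSingularities.ResolutionOfSingularities.Theorems.WildQuotientResolution.JordanFive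

variable (k : Type) [Field k] (n : ℕ) (a b c d e : Fin n)
  (hab : a ≠ b) (hac : a ≠ c) (had : a ≠ d) (hae : a ≠ e) (hbc : b ≠ c) (hbd : b ≠ d)
  (hbe : b ≠ e) (hcd : c ≠ d) (hce : c ≠ e) (hde : d ≠ e)

/-! ## Intertwining with the `J₅` law and with the deck involution -/

include hab hac had hae hbc hbd hbe hcd hce hde in
/-- **`coverSubst ∘ σ = σ_A ∘ coverSubst`**: the cover substitution intertwines the `J₅` law
`σ` (`x_b ↦ x_b + x_a, x_c ↦ x_c + x_b, x_d ↦ x_d + x_c, x_e ↦ x_e + x_d`) with the cover law `σ_A`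
(`s, Y₀` fixed, `Y_j ↦ Y_j + sY_{j−1}`). [OURS · L1 W4.5c] -/
theorem coverSubst_comp_eq (σ : MvPolynomial (Fin n) k ≃ₐ[k] MvPolynomial (Fin n) k)
    (hb : σ (X b) = X b + X a) (hc : σ (X c) = X c + X b) (hd : σ (X d) = X d + X c)
    (he : σ (X e) = X e + X d) (hσ : ∀ i, i ≠ b → i ≠ c → i ≠ d → i ≠ e → σ (X i) = X i)
    (σA : MvPolynomial (Option (Fin n)) k ≃ₐ[k] MvPolynomial (Option (Fin n)) k)
    (hAs : σA (X none) = X none)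
    (hA1 : σA (X (some b)) = X (some b) + X none * X (some a))
    (hA2 : σA (X (some c)) = X (some c) + X none * X (some b))
    (hA3 : σA (X (some d)) = X (some d) + X none * X (some c))
    (hA4 : σA (X (some e)) = X (some e) + X none * X (some d))
    (hAσ : ∀ i, i ≠ b → i ≠ c → i ≠ d → i ≠ e → σA (X (some i)) = X (some i)) :
    (coverSubst k n a b c d).comp (σ : MvPolynomial (Fin n) k →ₐ[k] MvPolynomial (Fin n) k) =
      (σA : MvPolynomial (Option (Fin n)) k →ₐ[k] MvPolynomial (Option (Fin n)) k).comp
        (coverSubst k n a b c d) := by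
  refine MvPolynomial.algHom_ext fun i => ?_
  simp only [AlgHom.comp_apply, AlgEquiv.coe_toAlgHom]
  by_cases hia : i = a
  · subst hia
    rw [hσ i hab hac had hae, coverSubst_X_a, map_mul, map_pow, hAs, hAσ i hab hac had hae]
  by_cases hib : i = b
  · subst hib
    rw [hb, map_add, coverSubst_X_b k n a i c d hab, coverSubst_X_a, map_mul, map_pow, hAs, hA1]
    ring
  by_cases hic : i = c
  · subst hic
    rw [hc, map_add, coverSubst_X_c k n a b i d hac hbc, coverSubst_X_b k n a b i d hab, map_mul,
      map_pow, hAs, hA2]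
    ring
  by_cases hid : i = d
  · subst hid
    rw [hd, map_add, coverSubst_X_d k n a b c i had hbd hcd, coverSubst_X_c k n a b c i hac hbc,
      map_mul, hAs, hA3]
    ring
  by_cases hie : i = e
  · subst hie
    rw [he, map_add, coverSubst_X_of_ne k n a b c d i hae.symm hbe.symm hce.symm hde.symm,
      coverSubst_X_d k n a b c d had hbd hcd, hA4]
  rw [hσ i hib hic hid hie, coverSubst_X_of_ne k n a b c d i hia hib hic hid, hAσ i hib hic hid hie]

include hab hac had hbc hbd hcd in
/-- **`τ_A ∘ coverSubst = coverSubst`**: the image of `k[x]` consists of even elements for the deck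
involution (`s, Y₁, Y₃ ↦ −s, −Y₁, −Y₃`). [OURS · L1 W4.5c] -/
theorem apply_coverSubst_of_tauLaws
    (τA : MvPolynomial (Option (Fin n)) k ≃ₐ[k] MvPolynomial (Option (Fin n)) k)
    (hτs : τA (X none) = -X none) (hτb : τA (X (some b)) = -X (some b))
    (hτd : τA (X (some d)) = -X (some d))
    (hτi : ∀ i, i ≠ b → i ≠ d → τA (X (some i)) = X (some i)) (F : MvPolynomial (Fin n) k) :
    τA (coverSubst k n a b c d F) = coverSubst k n a b c d F := by
  have key : (τA : MvPolynomial (Option (Fin n)) k →ₐ[k] MvPolynomial (Option (Fin n)) k).comp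
      (coverSubst k n a b c d) = coverSubst k n a b c d := by
    refine MvPolynomial.algHom_ext fun i => ?_
    simp only [AlgHom.comp_apply, AlgEquiv.coe_toAlgHom]
    by_cases hia : i = a
    · subst hia
      rw [coverSubst_X_a, map_mul, map_pow, hτs, hτi i hab had]; ring
    by_cases hib : i = b
    · subst hib
      rw [coverSubst_X_b k n a i c d hab, map_mul, map_pow, hτs, hτb]; ring
    by_cases hic : i = c
    · subst hic
      rw [coverSubst_X_c k n a b i d hac hbc, map_mul, map_pow, hτs, hτi i (Ne.symm hbc) hcd]; ring
    by_cases hid : i = d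
    · subst hid
      rw [coverSubst_X_d k n a b c i had hbd hcd, map_mul, hτs, hτd]; ring
    rw [coverSubst_X_of_ne k n a b c d i hia hib hic hid, hτi i hib hid]
  exact DFunLike.congr_fun key F

section ULevel

variable (I : Ideal (MvPolynomial (Option (Fin n)) k)) (ι : MvPolynomial (Option (Fin n)) k)
  (U : Type) [CommRing U] [Algebra (MvPolynomial (Option (Fin n)) k ⧸ I) U]
  [Algebra k U] [IsScalarTower k (MvPolynomial (Option (Fin n)) k ⧸ I) U]

include hab hac had hae hbc hbd hbe hcd hce hde in
/-- **`σ_U (π (coverSubst F)) = π (coverSubst (σ F))`** for any `σ_U` with the cover laws on `U`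
(`π : k[s,Y,pass] → k[s,Y,pass] ⧸ I → U`). [OURS · L1 W4.5c] -/
theorem cover_apply_algebraMap_coverSubst (σ : MvPolynomial (Fin n) k ≃ₐ[k] MvPolynomial (Fin n) k)
    (hb : σ (X b) = X b + X a) (hc : σ (X c) = X c + X b) (hd : σ (X d) = X d + X c)
    (he : σ (X e) = X e + X d) (hσ : ∀ i, i ≠ b → i ≠ c → i ≠ d → i ≠ e → σ (X i) = X i)
    (σU : U ≃ₐ[k] U)
    (hs : σU (algebraMap _ U (Ideal.Quotient.mk I (X none))) =
      algebraMap _ U (Ideal.Quotient.mk I (X none)))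
    (h1 : σU (algebraMap _ U (Ideal.Quotient.mk I (X (some b)))) =
      algebraMap _ U (Ideal.Quotient.mk I (X (some b))) +
        algebraMap _ U (Ideal.Quotient.mk I (X none)) *
          algebraMap _ U (Ideal.Quotient.mk I (X (some a))))
    (h2 : σU (algebraMap _ U (Ideal.Quotient.mk I (X (some c)))) =
      algebraMap _ U (Ideal.Quotient.mk I (X (some c))) +
        algebraMap _ U (Ideal.Quotient.mk I (X none)) *
          algebraMap _ U (Ideal.Quotient.mk I (X (some b))))
    (h3 : σU (algebraMap _ U (Ideal.Quotient.mk I (X (some d)))) =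
      algebraMap _ U (Ideal.Quotient.mk I (X (some d))) +
        algebraMap _ U (Ideal.Quotient.mk I (X none)) *
          algebraMap _ U (Ideal.Quotient.mk I (X (some c))))
    (h4 : σU (algebraMap _ U (Ideal.Quotient.mk I (X (some e)))) =
      algebraMap _ U (Ideal.Quotient.mk I (X (some e))) +
        algebraMap _ U (Ideal.Quotient.mk I (X none)) *
          algebraMap _ U (Ideal.Quotient.mk I (X (some d))))
    (hσ' : ∀ i, i ≠ b → i ≠ c → i ≠ d → i ≠ e →
      σU (algebraMap _ U (Ideal.Quotient.mk I (X (some i)))) =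
        algebraMap _ U (Ideal.Quotient.mk I (X (some i))))
    (F : MvPolynomial (Fin n) k) :
    σU (algebraMap _ U (Ideal.Quotient.mk I (coverSubst k n a b c d F))) =
      algebraMap _ U (Ideal.Quotient.mk I (coverSubst k n a b c d (σ F))) := by
  obtain ⟨σA, hAs, hA1, hA2, hA3, hA4, hAσ⟩ :=
    exists_coverSigma k n a b c d e hab hac had hae hbc hbd hbe hcd hce hde
  have hcomp := cover_laws_comp k n a b c d e I U σU σA hs h1 h2 h3 h4 hσ' hAs hA1 hA2 hA3 hA4 hAσ
  rw [cover_apply_algebraMap_mk k n I U σU σA hcomp]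
  have key := coverSubst_comp_eq k n a b c d e hab hac had hae hbc hbd hbe hcd hce hde σ hb hc hd he hσ
    σA hAs hA1 hA2 hA3 hA4 hAσ
  have := DFunLike.congr_fun key F
  simp only [AlgHom.comp_apply, AlgEquiv.coe_toAlgHom] at this
  rw [this]

include hab hac had hbc hbd hcd in
/-- **`τ_U (π (coverSubst F)) = π (coverSubst F)`** for any `τ_U` with the deck laws on `U`.
[OURS · L1 W4.5c] -/
theorem coverTau_apply_algebraMap_coverSubst (τU : U ≃ₐ[k] U)
    (τA : MvPolynomial (Option (Fin n)) k ≃ₐ[k] MvPolynomial (Option (Fin n)) k)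
    (hτs : τA (X none) = -X none) (hτb : τA (X (some b)) = -X (some b))
    (hτd : τA (X (some d)) = -X (some d))
    (hτi : ∀ i, i ≠ b → i ≠ d → τA (X (some i)) = X (some i))
    (hτU : ∀ o, τU (algebraMap _ U (Ideal.Quotient.mk I (X o))) =
      algebraMap _ U (Ideal.Quotient.mk I (τA (X o))))
    (F : MvPolynomial (Fin n) k) :
    τU (algebraMap _ U (Ideal.Quotient.mk I (coverSubst k n a b c d F))) =
      algebraMap _ U (Ideal.Quotient.mk I (coverSubst k n a b c d F)) := by
  rw [cover_apply_algebraMap_mk k n I U τU τA hτU,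
    apply_coverSubst_of_tauLaws k n a b c d hab hac had hbc hbd hcd τA hτs hτb hτd hτi]

end ULevel

/-! ## The centre dictionary -/

section Dictionary

variable {U : Type} [CommRing U] [IsDomain U] (θ : MvPolynomial (Option (Fin n)) k →+* U)
  (hs : θ (X none) ≠ 0)
  (hunit : IsUnit (θ (coverIHat (X none) (X (some a)) (X (some b)) (X (some c)) (X (some d))
    (X (some e)))))
  (u : {j : Fin 40 // j ≠ 0 ∧ j ≠ 2 ∧ j ≠ 5 ∧ j ≠ 13} → U)
  (hu : ∀ j, θ (coverSubst k n a b c d (iTwo k n a b c d e ^ 3)) * u j =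
    θ (coverSubst k n a b c d (gens12 k n a b c d j.1)))

include hab hac had hae hbc hbd hbe hcd hce hde hs hu in
/-- The chart ratios on the cover: `θ(î)³ · u_j = θ(s)^{w_j − 12} · θ(Y^{α_j})`. [OURS · L1 W4.5c] -/
theorem coverRatio_eq (j : {j : Fin 40 // j ≠ 0 ∧ j ≠ 2 ∧ j ≠ 5 ∧ j ≠ 13}) :
    θ (coverIHat (X none) (X (some a)) (X (some b)) (X (some c)) (X (some d)) (X (some e))) ^ 3 *
        u j =
      θ (X none) ^ (4 * (exps12 j.1).1 + 3 * (exps12 j.1).2.1 + 2 * (exps12 j.1).2.2.1 +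
          (exps12 j.1).2.2.2 - 12) *
        (θ (X (some a)) ^ (exps12 j.1).1 * θ (X (some b)) ^ (exps12 j.1).2.1 *
          θ (X (some c)) ^ (exps12 j.1).2.2.1 * θ (X (some d)) ^ (exps12 j.1).2.2.2) := by
  have h12 := (exps12_table j.1).1
  have h := hu j
  rw [map_pow, coverSubst_iTwo k n a b c d e hab hac had hae hbc hbd hbe hcd hce hde,
    coverSubst_gens12 k n a b c d hab hac had hbc hbd hcd, map_mul, map_pow, map_mul, map_pow] at h
  simp only [map_mul, map_pow] at h
  have hs12 : θ (X none) ^ 12 ≠ 0 := pow_ne_zero _ hs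
  apply mul_left_cancel₀ hs12
  have e : 4 * (exps12 j.1).1 + 3 * (exps12 j.1).2.1 + 2 * (exps12 j.1).2.2.1 + (exps12 j.1).2.2.2 =
      12 + (4 * (exps12 j.1).1 + 3 * (exps12 j.1).2.1 + 2 * (exps12 j.1).2.2.1 + (exps12 j.1).2.2.2
        - 12) := by omega
  rw [e, pow_add] at h
  linear_combination h

include hab hac had hae hbc hbd hbe hcd hce hde hs hunit hu in
/-- Each chart ratio lies in `(θ Y₁, θ Y₃)` (off `{0,2,5,13}` the generator `g_j` involves `x_b` or
`x_d`). [OURS · L1 W4.5c] -/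
theorem coverRatio_mem_span (j : {j : Fin 40 // j ≠ 0 ∧ j ≠ 2 ∧ j ≠ 5 ∧ j ≠ 13}) :
    u j ∈ Ideal.span ({θ (X none), θ (X (some b)), θ (X (some d))} : Set U) := by
  obtain ⟨v, hv⟩ := hunit
  have h := coverRatio_eq k n a b c d e hab hac had hae hbc hbd hbe hcd hce hde θ hs u hu j
  have hbd' := (exps12_table j.1).2.1 j.2
  have e : u j = ↑(v⁻¹ ^ 3) * (θ (X none) ^ (4 * (exps12 j.1).1 + 3 * (exps12 j.1).2.1 +
      2 * (exps12 j.1).2.2.1 + (exps12 j.1).2.2.2 - 12) *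
        (θ (X (some a)) ^ (exps12 j.1).1 * θ (X (some b)) ^ (exps12 j.1).2.1 *
          θ (X (some c)) ^ (exps12 j.1).2.2.1 * θ (X (some d)) ^ (exps12 j.1).2.2.2)) := by
    rw [← h, ← hv, ← mul_assoc, Units.val_pow_eq_pow_val, ← mul_pow, Units.inv_mul, one_pow,
      one_mul]
  rw [e]
  refine Ideal.mul_mem_left _ _ (Ideal.mul_mem_left _ _ ?_)
  have hBmem : θ (X (some b)) ∈ Ideal.span ({θ (X none), θ (X (some b)), θ (X (some d))} : Set U) :=
    Ideal.subset_span (Set.mem_insert_of_mem _ (Set.mem_insert _ _))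
  have hDmem : θ (X (some d)) ∈ Ideal.span ({θ (X none), θ (X (some b)), θ (X (some d))} : Set U) :=
    Ideal.subset_span (Set.mem_insert_of_mem _ (Set.mem_insert_of_mem _ rfl))
  rcases hbd' with hβ | hδ
  · obtain ⟨q, hq⟩ : θ (X (some b)) ∣ θ (X (some a)) ^ (exps12 j.1).1 *
        θ (X (some b)) ^ (exps12 j.1).2.1 * θ (X (some c)) ^ (exps12 j.1).2.2.1 *
        θ (X (some d)) ^ (exps12 j.1).2.2.2 :=
      ((Dvd.dvd.mul_left (dvd_pow_self _ hβ) _).mul_right _).mul_right _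
    rw [hq]
    exact Ideal.mul_mem_right _ _ hBmem
  · obtain ⟨q, hq⟩ : θ (X (some d)) ∣ θ (X (some a)) ^ (exps12 j.1).1 *
        θ (X (some b)) ^ (exps12 j.1).2.1 * θ (X (some c)) ^ (exps12 j.1).2.2.1 *
        θ (X (some d)) ^ (exps12 j.1).2.2.2 :=
      Dvd.dvd.mul_left (dvd_pow_self _ hδ) _
    rw [hq]
    exact Ideal.mul_mem_right _ _ hDmem

include hab hac had hae hbc hbd hbe hcd hce hde hs hunit hu in
/-- **The centre dictionary.**  Up to radical, the ideal of `U` generated by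
`θ(coverSubst x_a), …, θ(coverSubst x_d)` and the chart ratios `u_j` (`j ∉ {0,2,5,13}`) is the
ideal `(θ s, θ Y₁, θ Y₃)` of the `τ`-odd coordinates. [OURS · L1 W4.5c] -/
theorem radical_span_coverCentre_eq :
    (Ideal.span ((fun F => θ (coverSubst k n a b c d F)) '' {X a, X b, X c, X d} ∪
        Set.range u)).radical =
      (Ideal.span ({θ (X none), θ (X (some b)), θ (X (some d))} : Set U)).radical := by
  have hsmem : θ (X none) ∈ Ideal.span ({θ (X none), θ (X (some b)), θ (X (some d))} : Set U) :=
    Ideal.subset_span (Set.mem_insert _ _)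
  apply le_antisymm
  · refine Ideal.radical_mono (Ideal.span_le.2 ?_)
    rintro x (⟨F, hF, rfl⟩ | ⟨j, rfl⟩)
    · simp only [Set.mem_insert_iff, Set.mem_singleton_iff] at hF
      rcases hF with rfl | rfl | rfl | rfl
      · dsimp only
        rw [SetLike.mem_coe, coverSubst_X_a, map_mul, map_pow, pow_succ, mul_assoc]
        exact Ideal.mul_mem_left _ _ (Ideal.mul_mem_right _ _ hsmem)
      · dsimp only
        rw [SetLike.mem_coe, coverSubst_X_b k n a b c d hab, map_mul, map_pow, pow_succ, mul_assoc]
        exact Ideal.mul_mem_left _ _ (Ideal.mul_mem_right _ _ hsmem)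
      · dsimp only
        rw [SetLike.mem_coe, coverSubst_X_c k n a b c d hac hbc, map_mul, map_pow, pow_succ,
          mul_assoc]
        exact Ideal.mul_mem_left _ _ (Ideal.mul_mem_right _ _ hsmem)
      · dsimp only
        rw [SetLike.mem_coe, coverSubst_X_d k n a b c d had hbd hcd, map_mul]
        exact Ideal.mul_mem_right _ _ hsmem
    · exact coverRatio_mem_span k n a b c d e hab hac had hae hbc hbd hbe hcd hce hde θ hs hunit u hu j
  · -- `(θ s, θ Y₁, θ Y₃) ⊆ √⟨…⟩`
    set J := Ideal.span ((fun F => θ (coverSubst k n a b c d F)) '' {X a, X b, X c, X d} ∪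
        Set.range u) with hJ
    have hga : θ (X none) ^ 4 * θ (X (some a)) ∈ J := by
      have := Ideal.subset_span (s := (fun F => θ (coverSubst k n a b c d F)) '' {X a, X b, X c, X d} ∪
        Set.range u) (Or.inl ⟨X a, by simp, rfl⟩)
      dsimp only at this
      rwa [SetLike.mem_coe, coverSubst_X_a, map_mul, map_pow] at this
    have hgb : θ (X none) ^ 3 * θ (X (some b)) ∈ J := by
      have := Ideal.subset_span (s := (fun F => θ (coverSubst k n a b c d F)) '' {X a, X b, X c, X d} ∪
        Set.range u) (Or.inl ⟨X b, by simp, rfl⟩)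
      dsimp only at this
      rwa [SetLike.mem_coe, coverSubst_X_b k n a b c d hab, map_mul, map_pow] at this
    have hgc : θ (X none) ^ 2 * θ (X (some c)) ∈ J := by
      have := Ideal.subset_span (s := (fun F => θ (coverSubst k n a b c d F)) '' {X a, X b, X c, X d} ∪
        Set.range u) (Or.inl ⟨X c, by simp, rfl⟩)
      dsimp only at this
      rwa [SetLike.mem_coe, coverSubst_X_c k n a b c d hac hbc, map_mul, map_pow] at this
    have hgd : θ (X none) * θ (X (some d)) ∈ J := by
      have := Ideal.subset_span (s := (fun F => θ (coverSubst k n a b c d F)) '' {X a, X b, X c, X d} ∪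
        Set.range u) (Or.inl ⟨X d, by simp, rfl⟩)
      dsimp only at this
      rwa [SetLike.mem_coe, coverSubst_X_d k n a b c d had hbd hcd, map_mul] at this
    -- `sY_i ∈ √J`
    have hra : θ (X none) * θ (X (some a)) ∈ J.radical := ⟨4, by
      rw [show (θ (X none) * θ (X (some a))) ^ 4 = θ (X none) ^ 4 * θ (X (some a)) *
        θ (X (some a)) ^ 3 by ring]
      exact Ideal.mul_mem_right _ _ hga⟩
    have hrb : θ (X none) * θ (X (some b)) ∈ J.radical := ⟨3, by
      rw [show (θ (X none) * θ (X (some b))) ^ 3 = θ (X none) ^ 3 * θ (X (some b)) *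
        θ (X (some b)) ^ 2 by ring]
      exact Ideal.mul_mem_right _ _ hgb⟩
    have hrc : θ (X none) * θ (X (some c)) ∈ J.radical := ⟨2, by
      rw [show (θ (X none) * θ (X (some c))) ^ 2 = θ (X none) ^ 2 * θ (X (some c)) *
        θ (X (some c)) by ring]
      exact Ideal.mul_mem_right _ _ hgc⟩
    have hrd : θ (X none) * θ (X (some d)) ∈ J.radical := Ideal.le_radical hgd
    -- `s · î ∈ √J`, hence `s ∈ √J`
    have hsI : θ (X none) * θ (coverIHat (X none) (X (some a)) (X (some b)) (X (some c)) (X (some d))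
        (X (some e))) ∈ J.radical := by
      have e : θ (X none) * θ (coverIHat (X none) (X (some a)) (X (some b)) (X (some c)) (X (some d))
          (X (some e))) =
          θ (X none) * θ (X (some c)) * θ (X (some c)) -
            2 * (θ (X none) * θ (X (some b))) * θ (X (some d)) +
            2 * (θ (X none) * θ (X (some a))) * θ (X (some e)) +
            θ (X none) * θ (X (some a)) * (3 * θ (X none) * θ (X (some d))) -
            θ (X none) * θ (X (some b)) * (θ (X none) * θ (X (some c))) +
            θ (X none) * θ (X (some a)) * (θ (X none) ^ 2 * θ (X (some c))) := by
        simp only [coverIHat, map_add, map_sub, map_mul, map_pow, map_ofNat]; ring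
      rw [e]
      refine add_mem (sub_mem (add_mem (add_mem (sub_mem (Ideal.mul_mem_right _ _ hrc)
        (Ideal.mul_mem_right _ _ (Ideal.mul_mem_left _ _ hrb))) (Ideal.mul_mem_right _ _
        (Ideal.mul_mem_left _ _ hra))) (Ideal.mul_mem_right _ _ hra)) (Ideal.mul_mem_right _ _ hrb))
        (Ideal.mul_mem_right _ _ hra)
    have hsr : θ (X none) ∈ J.radical :=
      (Ideal.mul_unit_mem_iff_mem _ hunit).mp hsI
    -- `Y₁⁴, Y₃¹² ∈ J` from the ratios at `x_b⁴` and `x_d¹²`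
    obtain ⟨v, hv⟩ := hunit
    have hYb : θ (X (some b)) ∈ J.radical := by
      refine ⟨4, ?_⟩
      have h := coverRatio_eq k n a b c d e hab hac had hae hbc hbd hbe hcd hce hde θ hs u hu
        ⟨1, by decide⟩
      have e1 : exps12 1 = (0, 4, 0, 0) := rfl
      simp only [e1, pow_zero, one_mul, mul_one, Nat.mul_zero, Nat.add_zero, Nat.zero_add,
        show 3 * 4 - 12 = 0 from rfl] at h
      rw [← h]
      exact Ideal.mul_mem_left _ _ (Ideal.subset_span (Or.inr ⟨_, rfl⟩))
    have hYd : θ (X (some d)) ∈ J.radical := by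
      refine ⟨12, ?_⟩
      have h := coverRatio_eq k n a b c d e hab hac had hae hbc hbd hbe hcd hce hde θ hs u hu
        ⟨3, by decide⟩
      have e3 : exps12 3 = (0, 0, 0, 12) := rfl
      simp only [e3, pow_zero, one_mul, Nat.mul_zero, Nat.add_zero, Nat.zero_add,
        show (12 : ℕ) - 12 = 0 from rfl] at h
      rw [← h]
      exact Ideal.mul_mem_left _ _ (Ideal.subset_span (Or.inr ⟨_, rfl⟩))
    refine Ideal.radical_le_radical_iff.mpr (Ideal.span_le.2 ?_)
    rintro x hx
    simp only [Set.mem_insert_iff, Set.mem_singleton_iff] at hx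
    rcases hx with rfl | rfl | rfl
    · exact hsr
    · exact hYb
    · exact hYd

end Dictionary

end Summit.ResolutionOfSingularities.ResolutionOfSingularities.Theorems.WildQuotientResolution.JordanFive

end
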